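import Summits.Ventures.PercRepro.RankLevelSetRuleQModelMatroid
import Summits.Ventures.PercRepro.RankLevelSetCountBounds

/-!
# PercRepro — THE MODEL MATROID: COUNTING THE MEMBERS INSIDE AN INDEX SET (night-1, gen 14; step 3 of `ModelRecvEq`)

* **`ncard_subsets_inter_eq`** — the subsets `X ⊆ E` with `#X = m` and `#(X ∩ W) = j` number EXACTLY
  `C(#W, j)·C(#E − #W, m − j)` (the bijection `X ↦ (X ∩ W, X ∖ W)` onto pairs of subsets; the `≤` half is p7's
  `S2.ncard_subsets_inter_eq_le`, the pattern is reused);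
* **`ncard_subsets_inter_ge_eq`** — summed over `j ≥ j₀`: `Σ_{j ∈ Icc j₀ m} C(#W, j)·C(#E − #W, m − j)`;
* **`modelMatroid_memCount_eq`** — on the model at the tight layer, the members inside an index set `S` (`Z ⊆ S`, `Z ⊆ F`,
  `#Z = q`) number `Σ_{i ∈ Icc (#F − q) q} C(#(S ∩ F), i)·C(#(S ∖ F), q − i)` — the `q`-subsets of `S` with at least `#F − q`
  points in `F`, i.e. at most `q − m` points outside `F` (`#F = q + m`).
What remains for `ModelRecvEq` (successor): identify this sum with `mhat q (#F − q) (#(S ∩ F) − q) #(S ∖ F)` (Vandermonde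
`Σ_{t_P} C(q, t_P + t_D)·C(a, t_P) = C(q + a, q − t_D)` and the substitution `t = q − i`), count the index sets of each type
`(a, j)` (`C(#F − q, a)·C(#(E ∖ F), j)`), and regroup `ruleQRecv` by type into `rhat`.  Axioms: standard.
-/

namespace PercRepro

open Set

variable {α : Type}

/-- **Subsets by size and trace**: the `X ⊆ E` with `#X = m` and `#(X ∩ W) = j` number `C(#W, j)·C(#E − #W, m − j)`. -/
theorem ncard_subsets_inter_eq (E W : Finset α) (hW : W ⊆ E) (m j : ℕ) (hj : j ≤ m) :
    {X : Set α | X ⊆ (E : Set α) ∧ X.ncard = m ∧ (X ∩ (W : Set α)).ncard = j}.ncard =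
      W.card.choose j * (E.card - W.card).choose (m - j) := by
  classical
  set T : Set (Set α) := {X : Set α | X ⊆ (E : Set α) ∧ X.ncard = m ∧ (X ∩ (W : Set α)).ncard = j} with hT
  set A : Set (Set α) := {Y : Set α | Y ⊆ ((W : Finset α) : Set α) ∧ Y.ncard = j} with hA
  set Bs : Set (Set α) := {Y : Set α | Y ⊆ ((E \ W : Finset α) : Set α) ∧ Y.ncard = m - j} with hBs
  have hAcard : A.ncard = W.card.choose j := PercRepro.ncard_subsets_ncard_eq W j
  have hBcard : Bs.ncard = (E.card - W.card).choose (m - j) := by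
    rw [hBs, PercRepro.ncard_subsets_ncard_eq, Finset.card_sdiff_of_subset hW]
  have hinj : Set.InjOn (fun X : Set α => (X ∩ (W : Set α), X \ (W : Set α))) T := by
    rintro X ⟨hXE, -, -⟩ Y ⟨hYE, -, -⟩ hXY
    simp only [Prod.mk.injEq] at hXY
    rw [← Set.inter_union_sdiff X (W : Set α), hXY.1, hXY.2, Set.inter_union_sdiff]
  have himg : (fun X : Set α => (X ∩ (W : Set α), X \ (W : Set α))) '' T = A ×ˢ Bs := by
    ext ⟨Y₁, Y₂⟩
    simp only [Set.mem_image, Set.mem_prod, Prod.mk.injEq]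
    constructor
    · rintro ⟨X, ⟨hXE, hXm, hXj⟩, rfl, rfl⟩
      have hXfin : X.Finite := E.finite_toSet.subset hXE
      refine ⟨⟨inter_subset_right, hXj⟩, ⟨?_, ?_⟩⟩
      · rw [Finset.coe_sdiff]
        exact sdiff_subset_sdiff_left hXE
      · have h := Set.ncard_inter_add_ncard_sdiff_eq_ncard X (W : Set α) hXfin
        rw [hXj, hXm] at h
        omega
    · rintro ⟨⟨hY₁W, hY₁j⟩, ⟨hY₂, hY₂card⟩⟩
      rw [Finset.coe_sdiff] at hY₂
      have hY₁fin : Y₁.Finite := W.finite_toSet.subset hY₁W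
      have hY₂fin : Y₂.Finite := (E.finite_toSet.sdiff).subset hY₂
      have hdisj : Disjoint Y₁ Y₂ := by
        refine Set.disjoint_left.mpr ?_
        intro x hx1 hx2
        exact (hY₂ hx2).2 (hY₁W hx1)
      have hinterW : (Y₁ ∪ Y₂) ∩ (W : Set α) = Y₁ := by
        ext x
        constructor
        · rintro ⟨hx1, hx2⟩
          rcases hx1 with hx | hx
          · exact hx
          · exact absurd hx2 (hY₂ hx).2
        · intro hx
          exact ⟨Or.inl hx, hY₁W hx⟩
      have hdiffW : (Y₁ ∪ Y₂) \ (W : Set α) = Y₂ := by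
        ext x
        constructor
        · rintro ⟨hx1, hx2⟩
          rcases hx1 with hx | hx
          · exact absurd (hY₁W hx) hx2
          · exact hx
        · intro hx
          exact ⟨Or.inr hx, (hY₂ hx).2⟩
      refine ⟨Y₁ ∪ Y₂, ⟨?_, ?_, ?_⟩, hinterW, hdiffW⟩
      · exact union_subset (hY₁W.trans (Finset.coe_subset.2 hW)) (hY₂.trans sdiff_subset)
      · rw [Set.ncard_union_eq hdisj hY₁fin hY₂fin, hY₁j, hY₂card]
        omega
      · rw [hinterW, hY₁j]
  calc T.ncard = ((fun X : Set α => (X ∩ (W : Set α), X \ (W : Set α))) '' T).ncard :=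
        (hinj.ncard_image).symm
    _ = (A ×ˢ Bs).ncard := by rw [himg]
    _ = W.card.choose j * (E.card - W.card).choose (m - j) := by rw [Set.ncard_prod, hAcard, hBcard]

/-- Auxiliary downward induction for `ncard_subsets_inter_ge_eq`. -/
theorem ncard_subsets_inter_ge_eq_aux (E W : Finset α) (hW : W ⊆ E) (m : ℕ) :
    ∀ d j₀, m + 1 - j₀ = d →
      {X : Set α | X ⊆ (E : Set α) ∧ X.ncard = m ∧ j₀ ≤ (X ∩ (W : Set α)).ncard}.ncard =
        ∑ j ∈ Finset.Icc j₀ m, W.card.choose j * (E.card - W.card).choose (m - j) := by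
  intro d
  induction d with
  | zero =>
    intro j₀ hj₀
    have hgt : m < j₀ := by omega
    have hempty : {X : Set α | X ⊆ (E : Set α) ∧ X.ncard = m ∧ j₀ ≤ (X ∩ (W : Set α)).ncard} = ∅ := by
      ext X
      simp only [Set.mem_setOf_eq, Set.mem_empty_iff_false, iff_false]
      rintro ⟨hXE, hXm, hXj⟩
      have hXfin : X.Finite := E.finite_toSet.subset hXE
      have := Set.ncard_le_ncard (inter_subset_left : X ∩ (W : Set α) ⊆ X) hXfin
      omega
    rw [hempty, Set.ncard_empty, Finset.Icc_eq_empty (by omega), Finset.sum_empty]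
  | succ d ih =>
    intro j₀ hj₀
    have hle : j₀ ≤ m := by omega
    have hsplit : {X : Set α | X ⊆ (E : Set α) ∧ X.ncard = m ∧ j₀ ≤ (X ∩ (W : Set α)).ncard} =
        {X : Set α | X ⊆ (E : Set α) ∧ X.ncard = m ∧ (X ∩ (W : Set α)).ncard = j₀} ∪
        {X : Set α | X ⊆ (E : Set α) ∧ X.ncard = m ∧ j₀ + 1 ≤ (X ∩ (W : Set α)).ncard} := by
      ext X
      simp only [Set.mem_setOf_eq, Set.mem_union]
      constructor
      · rintro ⟨hXE, hXm, hXj⟩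
        rcases Nat.eq_or_lt_of_le hXj with h | h
        · exact Or.inl ⟨hXE, hXm, h.symm⟩
        · exact Or.inr ⟨hXE, hXm, h⟩
      · rintro (⟨hXE, hXm, hXj⟩ | ⟨hXE, hXm, hXj⟩)
        · exact ⟨hXE, hXm, hXj.ge⟩
        · exact ⟨hXE, hXm, by omega⟩
    have hdisj : Disjoint {X : Set α | X ⊆ (E : Set α) ∧ X.ncard = m ∧ (X ∩ (W : Set α)).ncard = j₀}
        {X : Set α | X ⊆ (E : Set α) ∧ X.ncard = m ∧ j₀ + 1 ≤ (X ∩ (W : Set α)).ncard} := by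
      refine Set.disjoint_left.mpr ?_
      rintro X ⟨-, -, h1⟩ ⟨-, -, h2⟩
      omega
    have hfin1 : {X : Set α | X ⊆ (E : Set α) ∧ X.ncard = m ∧ (X ∩ (W : Set α)).ncard = j₀}.Finite :=
      (E.finite_toSet.finite_subsets).subset (fun X hX => hX.1)
    have hfin2 : {X : Set α | X ⊆ (E : Set α) ∧ X.ncard = m ∧ j₀ + 1 ≤ (X ∩ (W : Set α)).ncard}.Finite :=
      (E.finite_toSet.finite_subsets).subset (fun X hX => hX.1)
    have hIcc : Finset.Icc j₀ m = insert j₀ (Finset.Icc (j₀ + 1) m) := by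
      ext j
      simp only [Finset.mem_Icc, Finset.mem_insert]
      omega
    rw [hsplit, Set.ncard_union_eq hdisj hfin1 hfin2, ncard_subsets_inter_eq E W hW m j₀ hle,
      ih (j₀ + 1) (by omega), hIcc, Finset.sum_insert (by simp)]

/-- **Subsets by size with a large trace**: the `X ⊆ E` with `#X = m` and `j₀ ≤ #(X ∩ W)` number
`Σ_{j ∈ Icc j₀ m} C(#W, j)·C(#E − #W, m − j)`. -/
theorem ncard_subsets_inter_ge_eq (E W : Finset α) (hW : W ⊆ E) (m j₀ : ℕ) :
    {X : Set α | X ⊆ (E : Set α) ∧ X.ncard = m ∧ j₀ ≤ (X ∩ (W : Set α)).ncard}.ncard =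
      ∑ j ∈ Finset.Icc j₀ m, W.card.choose j * (E.card - W.card).choose (m - j) :=
  ncard_subsets_inter_ge_eq_aux E W hW m _ j₀ rfl

/-- **The members inside an index set of the model**: at the tight layer (`F ⊆ E`, `#E = p + q`, `q < p`), for `S ⊆ E` the
members of the cell `(p, q)` inside `S` number `Σ_{i ∈ Icc (#F − q) q} C(#(S ∩ F), i)·C(#(S ∖ F), q − i)` — the `q`-subsets of
`S` with at least `#F − q` points in `F`. -/
theorem modelMatroid_memCount_eq {E F : Set α} (hE : E.Finite) (hF : F ⊆ E) {q p : ℕ} (hqp : q < p)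
    (hEcard : E.ncard = p + q) {S : Set α} (hSE : S ⊆ E) :
    memCount (modelMatroid hE F q p) p q S =
      ∑ i ∈ Finset.Icc (F.ncard - q) q, (S ∩ F).ncard.choose i * (S \ F).ncard.choose (q - i) := by
  classical
  have hSfin : S.Finite := hE.subset hSE
  have hSFfin : (S ∩ F).Finite := hSfin.inter_of_left F
  set E' : Finset α := hSfin.toFinset with hE'
  set W' : Finset α := hSFfin.toFinset with hW'
  have hEc : (E' : Set α) = S := Set.Finite.coe_toFinset _
  have hWc : (W' : Set α) = S ∩ F := Set.Finite.coe_toFinset _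
  have hW'E' : W' ⊆ E' := by
    rw [← Finset.coe_subset, hEc, hWc]
    exact inter_subset_left
  have hEcard' : E'.card = S.ncard := (Set.ncard_eq_toFinset_card S hSfin).symm
  have hWcard' : W'.card = (S ∩ F).ncard := (Set.ncard_eq_toFinset_card (S ∩ F) hSFfin).symm
  have hset : {Z : Set α | Z ∈ cellMembers (modelMatroid hE F q p) p q ∧ Z ⊆ S} =
      {X : Set α | X ⊆ (E' : Set α) ∧ X.ncard = q ∧ F.ncard - q ≤ (X ∩ (W' : Set α)).ncard} := by
    ext Z
    simp only [Set.mem_setOf_eq]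
    rw [modelMatroid_mem_cellMembers_iff hE hF hqp hEcard, hEc, hWc]
    constructor
    · rintro ⟨⟨hZE, hZq, hFq⟩, hZS⟩
      refine ⟨hZS, hZq, ?_⟩
      have : Z ∩ (S ∩ F) = Z ∩ F := by
        ext x
        constructor
        · rintro ⟨hx1, -, hx3⟩
          exact ⟨hx1, hx3⟩
        · rintro ⟨hx1, hx2⟩
          exact ⟨hx1, hZS hx1, hx2⟩
      rw [this]
      omega
    · rintro ⟨hZS, hZq, hFq⟩
      have : Z ∩ (S ∩ F) = Z ∩ F := by
        ext x
        constructor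
        · rintro ⟨hx1, -, hx3⟩
          exact ⟨hx1, hx3⟩
        · rintro ⟨hx1, hx2⟩
          exact ⟨hx1, hZS hx1, hx2⟩
      rw [this] at hFq
      exact ⟨⟨hZS.trans hSE, hZq, by omega⟩, hZS⟩
  unfold memCount
  rw [hset, ncard_subsets_inter_ge_eq E' W' hW'E' q (F.ncard - q), hEcard', hWcard']
  have h1 := Set.ncard_inter_add_ncard_sdiff_eq_ncard S F hSfin
  have h2 : S.ncard - (S ∩ F).ncard = (S \ F).ncard := by omega
  rw [h2]

end PercRepro
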